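import Summits.QuantumAdvantage.AdviceFreeQNC0.FixedBellsDense
import Summits.QuantumAdvantage.AdviceFreeQNC0.CleanGapStrategies
import Summits.QuantumAdvantage.AdviceFreeQNC0.LinFormsRegular
import HarnessLib

/-!
# Cell qa-qnc0, `p = 3` — WIN counts on a WINDOW FIBRE (planner qa-qnc0-p1 g20, ask P-20a(2) `RingWindowBellsSharp3`;
ROUND-19 §3 "condition on the outside, E-sum, then ≥ 21 bells inside ⇒ chain bound, else a bell-free sub-window ⇒ E2")

Walk coordinates, input `u = a ++ v ++ b` (`glue3`, `|v| = ℓ`), a selector `y` that does NOT READ the window `v` (so on the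
fibre `{a ++ v ++ b : v}` it is the constant selector of a fixed bell set):

* **sparse fibre** `three_mul_card_win_fibre_gap_le` — if no cut strictly inside the window fires on the fibre:
  `3·#{v : WIN} ≤ 2·2^ℓ + 2` (the cell's gap lemma `three_mul_card_win_fibre_le`, made fibrewise in its hypotheses);
* **dense fibre** `three_mul_card_win_fibre_dense_le` — if `≥ 42` cuts of `[p, p+ℓ)` carry bells of the fibre's bell set:
  `3·#{v : WIN} ≤ 2·2^ℓ`, by the FIBRE PATH SUM `fibre_signedSum_eq` (`TransferWalk.pathSum` on the window with the
  outside blocks frozen into a prefix factor and a suffix vector, summed over the end state `E`) and two disjoint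
  21-bell chains (`chain_bound`), `|Σ_v (−1)^{WIN}| ≤ 3√3·(5/8)^{10}·2^ℓ < 2^ℓ/20`.

WHAT THIS IS NOT: the assembly `ringWindowBellsSharp3` is in `WindowBells.lean`; crux 22907 untouched; separation NOT moved.
-/

noncomputable section

namespace Summit.QuantumAdvantage.AdviceFreeQNC0

namespace TransferWalk

open Finset Literature.Computability.QuantumComplexity Literature.Computability.MetaComplexity

variable {p ℓ q : ℕ}

/-! ## Sparse fibres -/

/-- **Sparse fibre**: a selector that does not read the window on THIS fibre and fires no cut strictly inside it wins on
`≤ (2·2^ℓ + 2)/3` window contents. -/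
theorem three_mul_card_win_fibre_gap_le (c : ℕ) (y : Fin (p + ℓ + q + 1) → (Fin (p + ℓ + q) → Bool) → Bool)
    (a : Fin p → Bool) (b : Fin q → Bool)
    (hy : ∀ (v v' : Fin ℓ → Bool) (g : Fin (p + ℓ + q + 1)), y g (glue3 a v b) = y g (glue3 a v' b))
    (hgap : ∀ g : Fin (p + ℓ + q + 1), p < g.val → g.val < p + ℓ → ∀ v, y g (glue3 a v b) = false) :
    3 * (univ.filter fun v : Fin ℓ → Bool => ringWinU c y (glue3 a v b) = true).card ≤ 2 * 2 ^ ℓ + 2 := by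
  set y' : Fin (p + ℓ + q + 1) → (Fin (p + ℓ + q) → Bool) → Bool := fun g _ => y g (glue3 a (fun _ => false) b)
    with hy'
  have heq : (univ.filter fun v : Fin ℓ → Bool => ringWinU c y (glue3 a v b) = true) =
      univ.filter fun v : Fin ℓ → Bool => ringWinU c y' (glue3 a v b) = true := by
    refine filter_congr fun v _ => ?_
    rw [LinForms.ringWinU_congr c (y := y) (y' := y') (fun g => hy v (fun _ => false) g)]
  rw [heq]
  exact three_mul_card_win_fibre_le c y' (fun g h1 h2 _ => hgap g h1 h2 _) (fun _ _ _ _ _ => rfl) a b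

/-! ## Walk positions on a glued input -/

/-- Before the window. -/
theorem posZ_glue3_of_le (a : Fin p → Bool) (v : Fin ℓ → Bool) (b : Fin q → Bool) {g : ℕ} (hg : g ≤ p) :
    posZ (glue3 a v b) g = posZ a g := by
  unfold posZ; rw [wtPrefix_glue3_of_le a v b hg]

/-- Inside the window. -/
theorem posZ_glue3_mid (a : Fin p → Bool) (v : Fin ℓ → Bool) (b : Fin q → Bool) {g : ℕ} (hg : g ≤ ℓ) :
    posZ (glue3 a v b) (p + g) = posZ a p + posZ v g := by
  unfold posZ
  have h1 : wtPrefix (glue3 a v b) (p + g) = wt a + wtPrefix v g := by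
    unfold glue3
    rw [wtPrefix_append_of_le _ _ (by omega : p + g ≤ p + ℓ), wtPrefix_append_of_ge _ _ (by omega : p ≤ p + g),
      Nat.add_sub_cancel_left]
  rw [h1, ← wt_eq_wtPrefix a]
  push_cast; ring

/-- After the window. -/
theorem posZ_glue3_of_ge (a : Fin p → Bool) (v : Fin ℓ → Bool) (b : Fin q → Bool) (i : ℕ) :
    posZ (glue3 a v b) (p + ℓ + i) = posZ a p + posZ v ℓ + posZ b i := by
  unfold posZ
  rw [wtPrefix_glue3_of_ge a v b (by omega : p + ℓ ≤ p + ℓ + i), show p + ℓ + i - (p + ℓ) = i by omega,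
    ← wt_eq_wtPrefix a, ← wt_eq_wtPrefix v]
  push_cast; ring

/-! ## The fibre path sum -/

/-- The prefix factor (cuts `< p`, frozen by the outside block `a`). -/
def preFac (bell : ℕ → Bool) (a : Fin p → Bool) (E : ZMod 3) : ℝ :=
  ∏ g ∈ range p, bfz bell g (2 + E + posZ a g)

/-- The suffix vector (cuts `≥ p + ℓ`, frozen by the outside block `b`, with the end-state indicator). -/
def sufVec (bell : ℕ → Bool) (p ℓ : ℕ) (b : Fin q → Bool) (E : ZMod 3) : ZMod 3 → ℝ := fun d =>
  (∏ i ∈ range (q + 1), bfz bell (p + ℓ + i) (d + posZ b i)) * (if d + posZ b q = 2 * E + 2 then 1 else 0)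

/-- `|preFac| ≤ 1`. -/
theorem preFac_sq_le (bell : ℕ → Bool) (a : Fin p → Bool) (E : ZMod 3) : preFac bell a E ^ 2 ≤ 1 := by
  unfold preFac
  rw [← Finset.prod_pow]
  exact Finset.prod_le_one (fun g _ => by positivity) fun g _ => bfz_sq_le bell g _

/-- `nsq sufVec ≤ 3`. -/
theorem nsq_sufVec_le (bell : ℕ → Bool) (p ℓ : ℕ) (b : Fin q → Bool) (E : ZMod 3) :
    nsq (sufVec bell p ℓ b E) ≤ 3 := by
  have h : ∀ d : ZMod 3, sufVec bell p ℓ b E d ^ 2 ≤ 1 := by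
    intro d
    unfold sufVec
    rw [mul_pow, ← Finset.prod_pow]
    have h1 : (∏ i ∈ range (q + 1), bfz bell (p + ℓ + i) (d + posZ b i) ^ 2) ≤ 1 :=
      Finset.prod_le_one (fun g _ => by positivity) fun g _ => bfz_sq_le bell _ _
    have h2 : (if d + posZ b q = 2 * E + 2 then (1 : ℝ) else 0) ^ 2 ≤ 1 := by split_ifs <;> norm_num
    have h0 : 0 ≤ (∏ i ∈ range (q + 1), bfz bell (p + ℓ + i) (d + posZ b i) ^ 2) :=
      Finset.prod_nonneg fun g _ => by positivity
    nlinarith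
  unfold nsq
  linarith [h 0, h 1, h 2]

/-- **The fibre path sum**: `Σ_v (−1)^{WIN_B(a ++ v ++ b)} = Σ_E preFac(E) · 2^ℓ · (seg_window sufVec_E)(2 + E + pos_p(a))`. -/
theorem fibre_signedSum_eq (B : Finset (Fin (p + ℓ + q + 1))) (a : Fin p → Bool) (b : Fin q → Bool) :
    ∑ v : Fin ℓ → Bool, (if ringWinU (p + ℓ + q + 2)
        (fun (g : Fin (p + ℓ + q + 1)) (_ : Fin (p + ℓ + q) → Bool) => decide (g ∈ B)) (glue3 a v b) = true
        then (-1 : ℝ) else 1) =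
      ∑ E : ZMod 3, preFac (fun g => decide (g ∈ B.map Fin.valEmbedding)) a E *
        (2 ^ ℓ * seg (fun g => decide (g ∈ B.map Fin.valEmbedding)) p ℓ
          (sufVec (fun g => decide (g ∈ B.map Fin.valEmbedding)) p ℓ b E) (2 + E + posZ a p)) := by
  set bell : ℕ → Bool := fun g => decide (g ∈ B.map Fin.valEmbedding) with hbell
  set S : ZMod 3 := posZ a p with hS
  -- the sign of one window content, blockwise
  have hsign : ∀ v : Fin ℓ → Bool, (if ringWinU (p + ℓ + q + 2)
      (fun (g : Fin (p + ℓ + q + 1)) (_ : Fin (p + ℓ + q) → Bool) => decide (g ∈ B)) (glue3 a v b) = true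
      then (-1 : ℝ) else 1) =
      ∑ E : ZMod 3, preFac bell a E *
        ((∏ g ∈ range ℓ, bfz bell (p + g) ((2 + E + S) + posZ v g)) * sufVec bell p ℓ b E ((2 + E + S) + posZ v ℓ)) := by
    intro v
    rw [sign_eq_prod B (glue3 a v b)]
    set Pn := posZ (glue3 a v b) (p + ℓ + q) with hPn
    have hPn' : Pn = S + posZ v ℓ + posZ b q := posZ_glue3_of_ge a v b q
    -- split the product into the three blocks
    have hsplit : (∏ g ∈ range (p + ℓ + q + 1), bfz bell g (2 + Pn + posZ (glue3 a v b) g)) =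
        (∏ g ∈ range p, bfz bell g (2 + Pn + posZ a g)) *
          ((∏ g ∈ range ℓ, bfz bell (p + g) (2 + Pn + (S + posZ v g))) *
            ∏ i ∈ range (q + 1), bfz bell (p + ℓ + i) (2 + Pn + (S + posZ v ℓ + posZ b i))) := by
      rw [show p + ℓ + q + 1 = p + (ℓ + (q + 1)) by ring, Finset.prod_range_add, Finset.prod_range_add]
      congr 1
      · exact Finset.prod_congr rfl fun g hg => by rw [posZ_glue3_of_le a v b (mem_range.1 hg).le]
      · congr 1
        · exact Finset.prod_congr rfl fun g hg => by rw [posZ_glue3_mid a v b (mem_range.1 hg).le]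
        · exact Finset.prod_congr rfl fun i _ => by rw [← add_assoc, posZ_glue3_of_ge a v b i]
    rw [hsplit]
    -- only the end state `E = Pn` contributes
    rw [Finset.sum_eq_single_of_mem Pn (mem_univ _) (fun E _ hE => ?_)]
    · unfold preFac sufVec
      have hind : 2 + Pn + S + posZ v ℓ + posZ b q = 2 * Pn + 2 := by linear_combination hPn'.symm
      rw [if_pos hind, mul_one]
      simp only [add_assoc]
    · unfold sufVec
      have hind : ¬ (2 + E + S + posZ v ℓ + posZ b q = 2 * E + 2) := by
        intro h
        apply hE
        rw [hPn']
        linear_combination -h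
      rw [if_neg hind, mul_zero, mul_zero, mul_zero]
  simp_rw [hsign]
  rw [Finset.sum_comm]
  refine Finset.sum_congr rfl fun E _ => ?_
  rw [← Finset.mul_sum, pathSum bell ℓ p (2 + E + S) (sufVec bell p ℓ b E)]

/-! ## Dense fibres -/

/-- Two disjoint 21-bell chains inside `[p, p+ℓ)` contract the window segment by `(5/8)^{20}` in squared norm. -/
theorem nsq_seg_window_le (bell : ℕ → Bool) (K : ℕ → ℕ) (hKmono : ∀ i j, i < j → j ≤ 41 → K i < K j)
    (hKbell : ∀ j, j ≤ 41 → bell (K j) = true) (hKgap : ∀ j g, j < 41 → K j < g → g < K (j + 1) → bell g = false)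
    (hK0 : p ≤ K 0) (hK41 : K 41 ≤ p + ℓ) (w : ZMod 3 → ℝ) :
    nsq (seg bell p ℓ w) ≤ (5 / 8 : ℝ) ^ 20 * nsq w := by
  have h020 : K 0 ≤ K 20 := (hKmono 0 20 (by norm_num) (by norm_num)).le
  have h2021 : K 20 ≤ K 21 := (hKmono 20 21 (by norm_num) (by norm_num)).le
  have h2141 : K 21 ≤ K 41 := (hKmono 21 41 (by norm_num) (by norm_num)).le
  -- split the segment at K 0, K 20, K 21, K 41
  have hs : seg bell p ℓ w = seg bell p (K 0 - p) (seg bell (K 0) (K 20 - K 0) (seg bell (K 20) (K 21 - K 20)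
      (seg bell (K 21) (K 41 - K 21) (seg bell (K 41) (p + ℓ - K 41) w)))) := by
    have e1 := seg_add bell (K 0 - p) p (p + ℓ - K 0) w
    rw [show K 0 - p + (p + ℓ - K 0) = ℓ by omega, show p + (K 0 - p) = K 0 by omega] at e1
    have e2 := seg_add bell (K 20 - K 0) (K 0) (p + ℓ - K 20) w
    rw [show K 20 - K 0 + (p + ℓ - K 20) = p + ℓ - K 0 by omega, show K 0 + (K 20 - K 0) = K 20 by omega] at e2
    have e3 := seg_add bell (K 21 - K 20) (K 20) (p + ℓ - K 21) w
    rw [show K 21 - K 20 + (p + ℓ - K 21) = p + ℓ - K 20 by omega, show K 20 + (K 21 - K 20) = K 21 by omega] at e3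
    have e4 := seg_add bell (K 41 - K 21) (K 21) (p + ℓ - K 41) w
    rw [show K 41 - K 21 + (p + ℓ - K 41) = p + ℓ - K 21 by omega, show K 21 + (K 41 - K 21) = K 41 by omega] at e4
    rw [e1, e2, e3, e4]
  rw [hs]
  have c1 := chain_bound bell K (fun i j hij hj => hKmono i j hij (by omega)) (fun j hj => hKbell j (by omega))
    (fun j g hj => hKgap j g (by omega)) 10 le_rfl
  have c2 := chain_bound bell (fun j => K (21 + j)) (fun i j hij hj => hKmono _ _ (by omega) (by omega))
    (fun j hj => hKbell _ (by omega)) (fun j g hj h1 h2 => hKgap (21 + j) g (by omega) h1 (by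
      rw [show 21 + (j + 1) = 21 + j + 1 by ring] at h2; exact h2)) 10 le_rfl
  simp only [show 20 - 2 * 10 = 0 from rfl, Nat.add_zero] at c1 c2
  set w4 := seg bell (K 41) (p + ℓ - K 41) w
  set w3 := seg bell (K 21) (K 41 - K 21) w4
  set w2 := seg bell (K 20) (K 21 - K 20) w3
  set w1 := seg bell (K 0) (K 20 - K 0) w2
  calc nsq (seg bell p (K 0 - p) w1) ≤ nsq w1 := nsq_seg_le bell _ _ _
    _ ≤ (5 / 8 : ℝ) ^ 10 * nsq w2 := c1 w2
    _ ≤ (5 / 8 : ℝ) ^ 10 * nsq w3 := mul_le_mul_of_nonneg_left (nsq_seg_le bell _ _ _) (by positivity)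
    _ ≤ (5 / 8 : ℝ) ^ 10 * ((5 / 8 : ℝ) ^ 10 * nsq w4) := mul_le_mul_of_nonneg_left (c2 w4) (by positivity)
    _ ≤ (5 / 8 : ℝ) ^ 10 * ((5 / 8 : ℝ) ^ 10 * nsq w) :=
        mul_le_mul_of_nonneg_left (mul_le_mul_of_nonneg_left (nsq_seg_le bell _ _ _) (by positivity)) (by positivity)
    _ = (5 / 8 : ℝ) ^ 20 * nsq w := by ring

/-- **Dense fibre** (constant bells): `≥ 42` bells at the cuts `[p, p+ℓ)` ⇒ `3·#{v : WIN} ≤ 2·2^ℓ`. -/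
theorem three_mul_card_win_fibre_dense_const_le (B : Finset (Fin (p + ℓ + q + 1))) (a : Fin p → Bool) (b : Fin q → Bool)
    (hB : 42 ≤ (B.filter fun g => p ≤ g.val ∧ g.val < p + ℓ).card) :
    3 * ((univ.filter fun v : Fin ℓ → Bool => ringWinU (p + ℓ + q + 2)
        (fun (g : Fin (p + ℓ + q + 1)) (_ : Fin (p + ℓ + q) → Bool) => decide (g ∈ B)) (glue3 a v b) = true).card : ℝ)
      ≤ 2 * (2 : ℝ) ^ ℓ := by
  classical
  set bell : ℕ → Bool := fun g => decide (g ∈ B.map Fin.valEmbedding) with hbell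
  -- the sorted bells inside the window
  set Bw : Finset ℕ := (B.filter fun g => p ≤ g.val ∧ g.val < p + ℓ).map Fin.valEmbedding with hBw
  have hcard : 42 ≤ Bw.card := by rw [hBw, Finset.card_map]; exact hB
  have hBw_mem : ∀ {g : ℕ}, g ∈ Bw ↔ g ∈ B.map Fin.valEmbedding ∧ p ≤ g ∧ g < p + ℓ := by
    intro g
    simp only [hBw, Finset.mem_map, Finset.mem_filter, Fin.valEmbedding_apply]
    constructor
    · rintro ⟨k, ⟨hk, h1, h2⟩, rfl⟩; exact ⟨⟨k, hk, rfl⟩, h1, h2⟩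
    · rintro ⟨⟨k, hk, rfl⟩, h1, h2⟩; exact ⟨k, ⟨hk, h1, h2⟩, rfl⟩
  set e := Bw.orderEmbOfFin (rfl : Bw.card = Bw.card) with he
  set K : ℕ → ℕ := fun j => if h : j < Bw.card then e ⟨j, h⟩ else 0 with hK
  have hKe : ∀ j (h : j < Bw.card), K j = e ⟨j, h⟩ := fun j h => by simp only [hK, dif_pos h]
  have hKmem : ∀ j, j < Bw.card → K j ∈ Bw := fun j h => by rw [hKe j h]; exact Finset.orderEmbOfFin_mem _ _ _
  have hKmono : ∀ i j, i < j → j ≤ 41 → K i < K j := by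
    intro i j hij hj
    rw [hKe i (by omega), hKe j (by omega)]
    exact e.strictMono (Fin.mk_lt_mk.2 hij)
  have hKbell : ∀ j, j ≤ 41 → bell (K j) = true := fun j hj => by
    simp only [hbell, decide_eq_true_eq]; exact (hBw_mem.1 (hKmem j (by omega))).1
  have hKgap : ∀ j g, j < 41 → K j < g → g < K (j + 1) → bell g = false := by
    intro j g hj h1 h2
    simp only [hbell, decide_eq_false_iff_not]
    intro hg
    have hgw : g ∈ Bw := by
      refine hBw_mem.2 ⟨hg, ?_, ?_⟩
      · exact le_trans (hBw_mem.1 (hKmem j (by omega))).2.1 h1.le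
      · exact lt_trans h2 (hBw_mem.1 (hKmem (j + 1) (by omega))).2.2
    have hr : g ∈ Set.range e := by rw [Finset.range_orderEmbOfFin]; exact hgw
    obtain ⟨i, hi⟩ := hr
    rw [hKe j (by omega), ← hi] at h1
    rw [hKe (j + 1) (by omega), ← hi] at h2
    have h1' := e.strictMono.lt_iff_lt.1 h1
    have h2' := e.strictMono.lt_iff_lt.1 h2
    rw [Fin.lt_def] at h1' h2'
    simp only at h1' h2'
    omega
  have hK0 : p ≤ K 0 := (hBw_mem.1 (hKmem 0 (by omega))).2.1
  have hK41 : K 41 ≤ p + ℓ := (hBw_mem.1 (hKmem 41 (by omega))).2.2.le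
  -- the signed count on the fibre
  set W := (univ.filter fun v : Fin ℓ → Bool => ringWinU (p + ℓ + q + 2)
    (fun (g : Fin (p + ℓ + q + 1)) (_ : Fin (p + ℓ + q) → Bool) => decide (g ∈ B)) (glue3 a v b) = true) with hW
  have hcount : ∑ v : Fin ℓ → Bool, (if ringWinU (p + ℓ + q + 2)
      (fun (g : Fin (p + ℓ + q + 1)) (_ : Fin (p + ℓ + q) → Bool) => decide (g ∈ B)) (glue3 a v b) = true
      then (-1 : ℝ) else 1) = (2 : ℝ) ^ ℓ - 2 * (W.card : ℝ) := by
    have h1 : ∀ v : Fin ℓ → Bool, (if ringWinU (p + ℓ + q + 2)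
        (fun (g : Fin (p + ℓ + q + 1)) (_ : Fin (p + ℓ + q) → Bool) => decide (g ∈ B)) (glue3 a v b) = true
        then (-1 : ℝ) else 1) = 1 - 2 * (if ringWinU (p + ℓ + q + 2)
        (fun (g : Fin (p + ℓ + q + 1)) (_ : Fin (p + ℓ + q) → Bool) => decide (g ∈ B)) (glue3 a v b) = true
        then (1 : ℝ) else 0) := by
      intro v; split_ifs <;> norm_num
    simp only [h1]
    rw [Finset.sum_sub_distrib, ← Finset.mul_sum, sum_const, card_univ, Fintype.card_fun, Fintype.card_bool,
      Fintype.card_fin, nsmul_eq_mul, mul_one, hW, natCast_card_filter]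
    push_cast; ring
  have hpath := fibre_signedSum_eq B a b
  -- each `E`-term is at most `2^ℓ · √3 · (5/8)^{10}`
  have hterm : ∀ E : ZMod 3, |preFac bell a E * (2 ^ ℓ * seg bell p ℓ (sufVec bell p ℓ b E) (2 + E + posZ a p))| ≤
      (2 : ℝ) ^ ℓ * (1 / 60) := by
    intro E
    have h1 : (preFac bell a E) ^ 2 ≤ 1 := preFac_sq_le bell a E
    have h2 : (seg bell p ℓ (sufVec bell p ℓ b E) (2 + E + posZ a p)) ^ 2 ≤ (5 / 8 : ℝ) ^ 20 * 3 :=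
      (sq_le_nsq _ _).trans ((nsq_seg_window_le bell K hKmono hKbell hKgap hK0 hK41 _).trans
        (mul_le_mul_of_nonneg_left (nsq_sufVec_le bell p ℓ b E) (by positivity)))
    have h3 : (5 / 8 : ℝ) ^ 20 * 3 ≤ (1 / 60 : ℝ) ^ 2 := by norm_num
    rw [abs_mul, abs_mul, abs_of_pos (by positivity : (0 : ℝ) < 2 ^ ℓ)]
    have h1' : (preFac bell a E) ^ 2 ≤ (1 : ℝ) ^ 2 := by rw [one_pow]; exact h1
    have ha : |preFac bell a E| ≤ 1 := abs_le_of_sq_le_sq h1' zero_le_one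
    have h2' : (seg bell p ℓ (sufVec bell p ℓ b E) (2 + E + posZ a p)) ^ 2 ≤ ((1 : ℝ) / 60) ^ 2 := h2.trans h3
    have hb : |seg bell p ℓ (sufVec bell p ℓ b E) (2 + E + posZ a p)| ≤ 1 / 60 :=
      abs_le_of_sq_le_sq h2' (by norm_num)
    have h4 : (0 : ℝ) ≤ 2 ^ ℓ := by positivity
    calc |preFac bell a E| * (2 ^ ℓ * |seg bell p ℓ (sufVec bell p ℓ b E) (2 + E + posZ a p)|)
        ≤ 1 * (2 ^ ℓ * (1 / 60)) := mul_le_mul ha (mul_le_mul_of_nonneg_left hb h4) (by positivity) zero_le_one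
      _ = (2 : ℝ) ^ ℓ * (1 / 60) := one_mul _
  have hsum : |∑ E : ZMod 3, preFac bell a E * (2 ^ ℓ * seg bell p ℓ (sufVec bell p ℓ b E) (2 + E + posZ a p))| ≤
      3 * ((2 : ℝ) ^ ℓ * (1 / 60)) := by
    refine (Finset.abs_sum_le_sum_abs _ _).trans ?_
    refine (Finset.sum_le_sum fun E _ => hterm E).trans ?_
    rw [sum_const, card_univ, ZMod.card]; simp
  rw [← hpath, hcount] at hsum
  have h2l : (0 : ℝ) < 2 ^ ℓ := by positivity
  have := (abs_le.1 hsum).1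
  nlinarith

/-- **Dense fibre** (adaptive selector not reading the window on this fibre). -/
theorem three_mul_card_win_fibre_dense_le (y : Fin (p + ℓ + q + 1) → (Fin (p + ℓ + q) → Bool) → Bool)
    (a : Fin p → Bool) (b : Fin q → Bool)
    (hy : ∀ (v v' : Fin ℓ → Bool) (g : Fin (p + ℓ + q + 1)), y g (glue3 a v b) = y g (glue3 a v' b))
    (hdense : 42 ≤ (univ.filter fun g : Fin (p + ℓ + q + 1) =>
      p ≤ g.val ∧ g.val < p + ℓ ∧ y g (glue3 a (fun _ => false) b) = true).card) :
    3 * ((univ.filter fun v : Fin ℓ → Bool => ringWinU (p + ℓ + q + 2) y (glue3 a v b) = true).card : ℝ)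
      ≤ 2 * (2 : ℝ) ^ ℓ := by
  classical
  set B : Finset (Fin (p + ℓ + q + 1)) := univ.filter fun g => y g (glue3 a (fun _ => false) b) = true with hB
  have heq : (univ.filter fun v : Fin ℓ → Bool => ringWinU (p + ℓ + q + 2) y (glue3 a v b) = true) =
      univ.filter fun v : Fin ℓ → Bool => ringWinU (p + ℓ + q + 2)
        (fun (g : Fin (p + ℓ + q + 1)) (_ : Fin (p + ℓ + q) → Bool) => decide (g ∈ B)) (glue3 a v b) = true := by
    refine filter_congr fun v _ => ?_
    rw [LinForms.ringWinU_congr (p + ℓ + q + 2) (y' := fun (g : Fin (p + ℓ + q + 1)) (_ : Fin (p + ℓ + q) → Bool) =>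
      decide (g ∈ B)) (fun g => by simp only [hB, mem_filter, mem_univ, true_and, Bool.decide_eq_true]; exact hy v _ g)]
  rw [heq]
  refine three_mul_card_win_fibre_dense_const_le B a b (le_trans hdense (le_of_eq ?_))
  congr 1
  ext g
  simp only [hB, mem_filter, mem_univ, true_and]
  tauto

end TransferWalk

end Summit.QuantumAdvantage.AdviceFreeQNC0

end
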